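import Summits.Langlands.Langlands.Theorems.PhantomRMYoshidaResiduallyYoshidaLiftingDefs
import Summits.Langlands.Langlands.Theorems.PhantomRMYoshidaResiduallyYoshidaLiftingNumericalCriterionDVR
import HarnessLib.Audit

/-!
# Line `yoshida-divisor-selmer-count` — checked skeleton for crux
`PhantomRMYoshida.ResiduallyYoshidaLifting`

LEAD COPY (re-seated lead prover-line-stmt-Langlands-13639-a1-0, 2026-08-16T17:30Z; byte-identical stubs, re-registered;
originally prover-line-stmt-Langlands-13639-0, 2026-08-16): the planner's skeleton with two free
reshapes taken from the standing `Disproof.lean` (T4(a): residual hypotheses restored in STUB 4;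
T4(b): positional (2,2)-chamber congruence added to `IsOrdinaryClassicalLimit`, which STUB 1 must now
deliver and STUB 4 may use). Composition `ResiduallyYoshidaLifting_of` unchanged in shape.

Item stmt-Langlands-13639 (route route-Langlands-PhantomRMYoshida, crux rank 2); idea card
`Cruxes/ResiduallyYoshidaLifting/Ideas/yoshida-divisor-selmer-count.md`, merged by the round-1
triage panel with `padic-l-function-as-steinberg-place` ≈ `endoscopic-crossing-euler` into ONE
line: "Λ-adic Wiles–Lenstra along the Yoshida divisor, `Φ ≤ BF ≤ θ ≤ 𝒞 = Ψ`, + ANT generic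
propagation". Planner planner-cruxplan-stmt-Langlands-13639-yoshida-divisor-selm-0, 2026-08-16.

CRUX. `p` odd; `σ̄, σ̄' : Γ_ℚ → GL₂(k)` odd irreducible non-conjugate with `det = ε̄⁻¹`;
`ρ₀, ρ : Γ_ℚ → GL₄(ℚ̄_p)` irreducible with `Sh` (symplectic-`ε⁻¹`, Greenberg-ordinary of shape
`(0,0,1,1)` and `p`-distinguished, residually `σ̄ ⊕ σ̄'` through `red`); `Aut ρ₀ → Aut ρ`.

THE LINE (closing (b) of the card, made unconditional in shape). Do not lift `ρ` at the
weight-`(2,2)` point: put it on the 2-variable big ordinary pseudodeformation space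
`R = R^{ps,ord}_{Λ₂}(tr σ̄ + tr σ̄')` (regular generic weight, similitude tied to the weight,
`dim R = 3`), whose reducible locus `Y = V(I) ≅ Spec(T_F ⊗̂ T_G)` (pairs of GL₂ Hida families;
3-dimensional and ENTIRELY MODULAR: `K ≤ I` for `K = ker(R ↠ T^{ord}_𝔪)`) is an anchor, not an
enemy —
1. at every height-one prime `P` of `Y` (`dim R/P = 2`) run the Wiles–Lenstra numerical criterion
   over the complete DVR `O_P` (residue field = fraction field of the Yoshida branch at `P`,
   characteristic `0` off the `μ`-part; finiteness of residue fields is never used) WITH THE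
   YOSHIDA BRANCH AS AUGMENTATION: `Φ_P` = length of the cotangent of `R_P` transverse to the
   branch `≤ ord_P char(Sel) ≤ ord_P θ_{3,2}` (Beilinson–Flach; KLZ17 Thm 11.6.4/11.6.6
   one-variable in print, 3-variable "expected", HsiehPalvannan2025 p. 9) and
   `ord_P θ_{3,2} ≤ ord_P 𝒞_Yos = Ψ_P` (congruence ideal of the Yoshida branch; Hsieh–Liu,
   announced; HP2025 (1.4)) — delivered as DATA plus the inequality `Φ ≤ Ψ`
   (`LocalCriterionDatum`, field `heightOne_criterion` of STUB 1) and turned into `R_P ≅ T_P` by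
   STUB 2 (pure algebra, provable now: the Iwasawa theory delivers LENGTHS, never isomorphisms);
2. propagate: the components of `Y` are components of `Spec R` and modular; a stable component
   crossing `Y` in codimension one is modular by 1 (`reflects`); `Spec R` is connected in
   dimension 2 and modularity passes across two-dimensional meetings of STABLE components
   (Thorne / Allen–Newton–Thorne patching at a one-dimensional prime with absolutely irreducible
   residual representation — the NOT-blocked evasion (c) of `ResiduallyReducibleBarrierNarrow`);
   so EVERY irreducible component of `Spec R` is modular (STUB 3, pure algebra, provable now);
3. hence `x_ρ` lies on a modular weight-dominant component and `ρ` is a `p`-adic limit, on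
   Frobenius polynomials, of the Galois representations of classical cuspidal Siegel eigenforms of
   regular weights `(k₁,k₂) → (2,2)` in the family (field `classicalLimit`: `IsOrdinaryClassicalLimit ρ`);
4. weight-`(2,2)` classicality of ordinary `p`-distinguished classical limits + `GSp₄ → GL₄`
   (STUB 4: BoxerEtAl2021 §4–7 / Pilloni2020 higher Hida theory, GeeTaibi2019) gives `Aut ρ`.
`ResiduallyYoshidaLifting_of : stub₁ → stub₂ → stub₃ → stub₄ → ResiduallyYoshidaLifting` is the
kernel-checked composition (no `sorry` outside the four `stub_*`; hypotheses keyed BY NAME through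
`Registered.stub_*`, the device of `Cruxes/LagHandOff/Lines/crosscut-dictionary.lean`).

STATUS / HONESTY. The line is ABSOLUTE: `Aut ρ₀` is not consumed (Disproof.lean
`iff_absoluteOnFibres` — on a fibre containing an automorphic point the relative and the absolute
statement coincide; closing (b) proves the absolute one and thereby re-imports a Λ-adic
quantitative `StableYoshidaCongruence` through the `Ψ`-side, as triage r1-1/2/3 record).
`ρ.IsIrreducible` (load-bearing: `not_withoutIrreducibleρ_of_witness`) is spent in STUB 4
(cuspidality on `GL₄`) and handed to STUB 1; oddness (`iff_withoutOdd`) and the a.e.-unramified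
conjuncts of `Sh` (`shC_iff_without_residual_unramified`) are decoration and unused; `(k, red)`
enter only through `Sh` (`map_red_eq_iff`). No `_false_without_` theorem beyond these and no
landed `Theorems/ResiduallyYoshidaLifting/Negative/` lemma exist (2026-08-16); `ledger negatives
--problem Langlands` (1 entry, K3 Kuga–Satake anchor) is untouched by every stub. LOGICAL GRAIN:
given the algebra STUBS 2–3, STUB 1 is equivalent to "every irreducible `Sh`-representation with
residual pair `(σ̄, σ̄')` is an ordinary classical limit"; the datum records HOW (height-one
Wiles–Lenstra + propagation), keeps that division of labour kernel-checked, and is where a stub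
worker plugs the Hida-theoretic objects once they are requested as definitions.

TRIAGE SHARPENINGS ACTED ON. (r1-2 i, r1-3) the divisor property `dim(C ∩ Y) = 2` is NOT assumed:
badly attached stable components are reached through `connected₂` + `generic_propagation`; the
card's closing (a) (`h = 1`, multiplicity one, uses `ρ₀`) survives as a reshaping option only (line
card §Reshape). (r1-1, r1-2 ii) the `Ψ`-side is `θ ∣ 𝒞` (Hsieh–Liu, unpublished), NOT HP2025
Thm mainconj2 (the Ribet direction). (r1-2 iii–v, r1-3 S1) `(yos)`/auxiliary level, `(tor)`, `(BI)`,
normality of `𝕀` at `P`, the `μ`-part and `p = 3`/dihedral sub-cases are priced in STUB 1's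
docstring. (r1-2 on padic-l-function ii) the GL₂ congruence modules of `F, G` at `P` sit on both
sides (`A`, `B` are the full local rings). (r1-1 crux-sharpen `5 ≤ p`) cannot be adopted by a line
(the crux is fixed); it is the first scope risk of STUB 1.
-/
noncomputable section

set_option linter.dupNamespace false
set_option linter.overlappingInstances false
set_option autoImplicit false

open IsDedekindDomain Filter
open Literature.NumberTheory.GaloisRepresentations Literature.NumberTheory.Automorphic

namespace Summit.Langlands.Langlands.Cruxes.ResiduallyYoshidaLifting.YoshidaDivisorSelmerCount

/-! ## Vocabulary

`εb`, `DetC`, `Aut`, `Sh`, `IsOrdinaryClassicalLimit`, `IsConnectedInDimTwo` are IMPORTED from the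
landed `Theorems/PhantomRMYoshidaResiduallyYoshidaLiftingDefs.lean` (p73762, same namespace; the
first four verbatim the crux's inline `let`s). STUB 3 `stub_stableComponentsModular` landed there
(p73762) and STUB 2 `stub_numericalCriterionDVR` in
`Theorems/PhantomRMYoshidaResiduallyYoshidaLiftingNumericalCriterionDVR.lean` (p78501); both are
imported and consumed below BY NAME. -/

/-! ## Objects posited by the line (interfaces only; existence is `stub_yoshidaFamily`) -/

/-- THE HEIGHT-ONE NUMERICAL-CRITERION DATUM at a prime `P` of `R` (intended: `P ⊇ I` a height-one
prime of the Yoshida divisor `Y = V(I)`, `K = ker(R ↠ T)` the modular ideal).  Wiles–Lenstra data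
`A ↠ B → O` over a complete DVR `O` (intended: `O` = completed local ring of the Yoshida branch
`R/I ≅ 𝕀_{F,G}` at `P/I`, whose residue field has characteristic `0` off the `μ`-part; `A = R_P^∧ ⊗ O`,
`B = T_P^∧ ⊗ O` finite free; `π` = the Yoshida branch as augmentation), TOGETHER WITH the Iwasawa-
theoretic inequality `Φ ≤ Ψ` (`Φ` = `O`-length of the cotangent `𝔭_A/𝔭_A²`, `𝔭_A = ker(π ∘ φ)`;
`Ψ` = `O`-length of `O/η`, `η = π(Ann_B ker π)` the congruence ideal of the Yoshida branch) and the
MEANING of the criterion's conclusion back in `R` (`reflects`: if `φ` is bijective then every minimal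
prime of `R` inside `P` is modular).  NO bijectivity is asserted: that is `stub_numericalCriterionDVR`. -/
structure LocalCriterionDatum {R : Type} [CommRing R] (K P : Ideal R) : Type 1 where
  /-- the base: a complete discrete valuation ring (ANY residue field) -/
  O : Type
  [commRingO : CommRing O]
  [isDomainO : IsDomain O]
  [dvrO : IsDiscreteValuationRing O]
  [completeO : IsAdicComplete (IsLocalRing.maximalIdeal O) O]
  /-- the deformation side: a complete Noetherian local `O`-algebra -/
  A : Type
  [commRingA : CommRing A]
  [localA : IsLocalRing A]
  [noetherianA : IsNoetherianRing A]
  [algebraA : Algebra O A]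
  [completeA : IsAdicComplete (IsLocalRing.maximalIdeal A) A]
  /-- the Hecke side: a local `O`-algebra, finite free as an `O`-module -/
  B : Type
  [commRingB : CommRing B]
  [localB : IsLocalRing B]
  [algebraB : Algebra O B]
  [finiteB : Module.Finite O B]
  [freeB : Module.Free O B]
  /-- `R → T` at `P` -/
  φ : A →ₐ[O] B
  /-- the Yoshida branch as augmentation -/
  π : B →ₐ[O] O
  surjective : Function.Surjective φ
  /-- the congruence ideal `η = π(Ann_B(ker π))` is non-zero -/
  eta_ne_bot : Ideal.map (π : B →+* O) (RingHom.ker (π : B →+* O)).annihilator ≠ ⊥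
  /-- `Φ ≤ Ψ`: (Beilinson–Flach upper bound on the transverse cotangent) ≤ (congruence length) -/
  phi_le_psi : Module.length O (RingHom.ker ((π : B →+* O).comp (φ : A →+* B))).Cotangent ≤
      Module.length O (O ⧸ Ideal.map (π : B →+* O) (RingHom.ker (π : B →+* O)).annihilator)
  /-- meaning: `R_P ≅ T_P` puts every irreducible component of `Spec R` through `P` inside `Spec T` -/
  reflects : Function.Bijective φ → ∀ 𝔮 ∈ minimalPrimes R, 𝔮 ≤ P → K ≤ 𝔮

attribute [instance] LocalCriterionDatum.commRingO LocalCriterionDatum.isDomainO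
  LocalCriterionDatum.dvrO LocalCriterionDatum.completeO LocalCriterionDatum.commRingA
  LocalCriterionDatum.localA LocalCriterionDatum.noetherianA LocalCriterionDatum.algebraA
  LocalCriterionDatum.completeA LocalCriterionDatum.commRingB LocalCriterionDatum.localB
  LocalCriterionDatum.algebraB LocalCriterionDatum.finiteB LocalCriterionDatum.freeB

/-- THE `Λ`-ADIC YOSHIDA FAMILY DATUM of `ρ` — the interface the line is stated over (existence is
STUB 1, never smuggled: every field below is a claim about the intended instance
`R = R^{ps,ord}_{Λ₂,N}(tr σ̄ + tr σ̄')`, `I` = reducibility ideal, `K = ker(R ↠ T^{ord}_{𝔪,N})`).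
Only `R` is a ring here; `T` enters through `K` and through the Hecke sides `B` of the local
criterion data; `Λ₂` enters through Krull dimensions only. -/
structure YoshidaFamilyDatum (p : ℕ) [Fact p.Prime] (hcpt : isCompact_glFiniteIntegralLevel 4 ℚ)
    (ι : PadicAlgCl p ≃+* ℂ) (k : Type) [Field k] [TopologicalSpace k]
    (red : Valued.integer (PadicAlgCl p) →+* k) (σ σ' : FramedGaloisRep ℚ k 2)
    (ρ : FramedGaloisRep ℚ (PadicAlgCl p) 4) : Type 1 where
  /-- the big ordinary pseudodeformation ring `R = R^{ps,ord}_{Λ₂,N}(tr σ̄ + tr σ̄')` -/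
  R : Type
  [commRing : CommRing R]
  [isNoetherianRing : IsNoetherianRing R]
  [isLocalRing : IsLocalRing R]
  /-- the reducibility ideal (`V(I) = Y`, the Yoshida divisor) -/
  I : Ideal R
  /-- the modular ideal `K = ker(R ↠ T^{ord}_𝔪)` -/
  K : Ideal R
  /-- the Yoshida (endoscopic) family is automorphic: `Y ⊆ Spec T` -/
  modular_le_reducible : K ≤ I
  /-- the universal Frobenius polynomials (a.e. `v`) -/
  univPoly : HeightOneSpectrum (NumberField.RingOfIntegers ℚ) → Polynomial R
  /-- the point of `ρ` -/
  x : R →+* PadicAlgCl p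
  charpoly_x : ∀ᶠ v : HeightOneSpectrum (NumberField.RingOfIntegers ℚ) in Filter.cofinite,
    ρ.HasFrobCharpolyAt v ((univPoly v).map x)
  /-- the Yoshida divisor is a union of irreducible components of `Spec R` (full `Λ`-dimension) -/
  yoshida_minimal : ∃ 𝔮 ∈ minimalPrimes R, I ≤ 𝔮
  /-- `Spec R` is connected in dimension `2` -/
  connected₂ : IsConnectedInDimTwo R
  /-- generic propagation between STABLE components meeting in dimension `≥ 2` -/
  generic_propagation : ∀ 𝔮₁ ∈ minimalPrimes R, ∀ 𝔮₂ ∈ minimalPrimes R, ¬ I ≤ 𝔮₁ → ¬ I ≤ 𝔮₂ →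
    (2 : WithBot ℕ∞) ≤ ringKrullDim (R ⧸ (𝔮₁ ⊔ 𝔮₂)) → K ≤ 𝔮₁ → K ≤ 𝔮₂
  /-- at every height-one prime of the Yoshida divisor: the numerical-criterion datum with `Φ ≤ Ψ` -/
  heightOne_criterion : ∀ P : Ideal R, P.IsPrime → I ≤ P → ringKrullDim (R ⧸ P) = 2 →
    Nonempty (LocalCriterionDatum K P)
  /-- Galois points of modular irreducible components are ordinary classical limits -/
  classicalLimit : ∀ (r : FramedGaloisRep ℚ (PadicAlgCl p) 4) (y : R →+* PadicAlgCl p),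
    r.toGaloisRep.IsIrreducible → Sh p k red σ σ' r →
      (∀ᶠ v : HeightOneSpectrum (NumberField.RingOfIntegers ℚ) in Filter.cofinite,
        r.HasFrobCharpolyAt v ((univPoly v).map y)) →
      (∃ 𝔮 ∈ minimalPrimes R, 𝔮 ≤ RingHom.ker y ∧ K ≤ 𝔮) → IsOrdinaryClassicalLimit p hcpt ι r

attribute [instance] YoshidaFamilyDatum.commRing YoshidaFamilyDatum.isNoetherianRing
  YoshidaFamilyDatum.isLocalRing

/-! ## The four stub STATEMENTS (named `Prop`s) -/

/-- Statement of STUB 1 (`stub_yoshidaFamily`): the Λ-adic Yoshida family datum exists. -/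
def YoshidaFamilyExists : Prop :=
  ∀ (p : ℕ) [Fact p.Prime], p ≠ 2 → ∀ (k : Type) [Field k] [CharP k p] [IsAlgClosed k]
    [TopologicalSpace k] [DiscreteTopology k] (red : Valued.integer (PadicAlgCl p) →+* k)
    (σ σ' : FramedGaloisRep ℚ k 2) (hcpt : isCompact_glFiniteIntegralLevel 4 ℚ) (ι : PadicAlgCl p ≃+* ℂ)
    (ρ : FramedGaloisRep ℚ (PadicAlgCl p) 4),
    σ.toGaloisRep.IsIrreducible → σ'.toGaloisRep.IsIrreducible → DetC p k σ σ' →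
    (¬ ∃ g : GL (Fin 2) k, ∀ x, g * σ x * g⁻¹ = σ' x) →
    ρ.toGaloisRep.IsIrreducible → Sh p k red σ σ' ρ →
    Nonempty (YoshidaFamilyDatum p hcpt ι k red σ σ' ρ)

/-- Statement of STUB 2 (`stub_numericalCriterionDVR`): Wiles–Lenstra over a complete DVR, any residue field. -/
def NumericalCriterionDVR : Prop :=
  ∀ (O : Type) [CommRing O] [IsDomain O] [IsDiscreteValuationRing O]
    [IsAdicComplete (IsLocalRing.maximalIdeal O) O]
    (A : Type) [CommRing A] [IsLocalRing A] [IsNoetherianRing A] [Algebra O A]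
    [IsAdicComplete (IsLocalRing.maximalIdeal A) A]
    (B : Type) [CommRing B] [IsLocalRing B] [Algebra O B] [Module.Finite O B] [Module.Free O B]
    (φ : A →ₐ[O] B) (π : B →ₐ[O] O),
    Function.Surjective φ →
    Ideal.map (π : B →+* O) (RingHom.ker (π : B →+* O)).annihilator ≠ ⊥ →
    Module.length O (RingHom.ker ((π : B →+* O).comp (φ : A →+* B))).Cotangent ≤
      Module.length O (O ⧸ Ideal.map (π : B →+* O) (RingHom.ker (π : B →+* O)).annihilator) →
    Function.Bijective φ

/-- Statement of STUB 3 (`stub_stableComponentsModular`): propagation through the component graph. -/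
def StableComponentsModular : Prop :=
  ∀ (R : Type) [CommRing R] [IsNoetherianRing R] [IsLocalRing R] (I K : Ideal R), K ≤ I →
    (∃ 𝔮 ∈ minimalPrimes R, I ≤ 𝔮) → IsConnectedInDimTwo R →
    (∀ 𝔮₁ ∈ minimalPrimes R, ∀ 𝔮₂ ∈ minimalPrimes R, ¬ I ≤ 𝔮₁ → ¬ I ≤ 𝔮₂ →
      (2 : WithBot ℕ∞) ≤ ringKrullDim (R ⧸ (𝔮₁ ⊔ 𝔮₂)) → K ≤ 𝔮₁ → K ≤ 𝔮₂) →
    (∀ P : Ideal R, P.IsPrime → I ≤ P → ringKrullDim (R ⧸ P) = 2 →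
      ∀ 𝔮 ∈ minimalPrimes R, 𝔮 ≤ P → K ≤ 𝔮) →
    ∀ 𝔮 ∈ minimalPrimes R, K ≤ 𝔮

/-- Statement of STUB 4 (`stub_ordinaryLimitClassicality`): weight-(2,2) classicality of ordinary classical limits. -/
def OrdinaryLimitClassicality : Prop :=
  ∀ (p : ℕ) [Fact p.Prime], p ≠ 2 → ∀ (k : Type) [Field k] [CharP k p] [IsAlgClosed k]
    [TopologicalSpace k] [DiscreteTopology k] (red : Valued.integer (PadicAlgCl p) →+* k)
    (σ σ' : FramedGaloisRep ℚ k 2) (hcpt : isCompact_glFiniteIntegralLevel 4 ℚ) (ι : PadicAlgCl p ≃+* ℂ)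
    (r : FramedGaloisRep ℚ (PadicAlgCl p) 4),
    σ.toGaloisRep.IsIrreducible → σ'.toGaloisRep.IsIrreducible → DetC p k σ σ' →
    (¬ ∃ g : GL (Fin 2) k, ∀ x, g * σ x * g⁻¹ = σ' x) →
    r.toGaloisRep.IsIrreducible → Sh p k red σ σ' r → IsOrdinaryClassicalLimit p hcpt ι r →
    Aut p hcpt ι r

/-! ## The registered stubs still open (STUBS 2–3 are landed theorems, imported) -/

/-- **STUB 1 (XL, OPEN — the hardest; all the number theory of the line except classicality) —
the Λ-adic Yoshida family datum of `ρ` exists.** For `p` odd, `σ̄, σ̄'` irreducible non-conjugate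
with `det σ̄ = det σ̄' = ε̄⁻¹`, and `ρ` irreducible with `Sh ρ`, there is a `YoshidaFamilyDatum`.
Intended instance and sources, field by field:
* `R` — Chenevier-determinant / Bellaïche–Chenevier GMA pseudodeformation ring of `tr σ̄ + tr σ̄'`,
  `B`-ordinary at `p` (well posed because the four residual characters at `p` are distinct =
  HP2025 `(pdist-gsp4)` = the crux's `IsResiduallyDistinguishedAt`; Wake–Wang-Erickson ordinary
  pseudorepresentations), over `Λ₂ = 𝒪⟦x₁,x₂⟧`, similitude `ε⁻¹·`(weight character), tame level
  `N ⊇ cond ρ` enlarged by auxiliary primes `q ≡ −1 (p)`, `Frob_q ∼ c` for `(yos)`; `I` its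
  reducibility ideal; `K = ker(R → T)`, `T` the big ordinary Hecke algebra of the 2-variable
  higher-Hida complex (Pilloni2012, BoxerEtAl2021) at the Yoshida maximal ideal, replaced by its
  maximal `Λ₂`-torsion-free quotient (only weight-dominant components matter below), `R → T` by
  gluing the pseudocharacters of classical points (HP2025 Thm 4.6); `univPoly v` the universal
  Frobenius polynomial (`v ∤ Np`); `x` the point of `ρ` (ordinary: a `B`-ordinary refinement
  exists by `p`-distinguishedness).
* `modular_le_reducible` (`Y ⊆ Spec T`): GL₂ big ordinary `R = T` for `σ̄, σ̄'` (Wiles, Diamond,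
  SkinnerWiles2001) + Λ-adic Yoshida lifts of every pair of Hida families (HP2025 Thm
  yoshidafamily; needs `(yos)`, hence the auxiliary level).
* `yoshida_minimal` (`Y` is a union of components of `Spec R`, `dim = 3`): generic Λ-torsionness of
  the Rankin–Selberg Selmer module `X` (KLZ17) ⇒ no transverse tangent directions at the generic
  points of `Y` (Bellaïche–Chenevier); Disproof.lean "Engine numerics": expected codimension 0.
* `connected₂`: SGA2 XIII.2.1 when `R ≅ Λ₂⟦y₁…y_h⟧/(f₁…f_h)` (balanced Greenberg–Wiles count
  `h¹ − h² = 0` over `Λ₂`); Hartshorne's connectedness for `S₂` rings in general (determinantal GMA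
  structure) — UNPROVED for pseudodeformation rings (risk a).
* `generic_propagation`: Thorne2015 / AllenNewtonThorne2020 §3 — Taylor–Wiles patching at a
  one-dimensional prime `𝔭 ⊂ 𝔮₁ + 𝔮₂` of characteristic `p` with `ρ_𝔭` absolutely irreducible
  and adequate (such `𝔭` exist: the reducible part of `V(𝔮₁ + 𝔮₂)` is a proper closed subset),
  transplanted to `GSp₄/ℚ` ordinary families (Genestier–Tilouine, BoxerEtAl2021 §7) — XL, not in
  print (risk b).
* `heightOne_criterion`: at `P ⊇ I`, `dim R/P = 2`: `O` = completed (normalised) local ring of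
  the Yoshida branch `𝕀 = R/I` at `P/I` — a complete DVR with residue field `κ(P)`, of
  characteristic `0` unless `P ∋ p` (the `μ`-part); `A = R_P^∧`, `B = T_P^∧` made `O`-algebras
  through the unique section of the étale `Λ_𝔭^∧ → O` (if `𝕀_P/Λ_𝔭` is ramified, base-change to
  `O`: the different then enters `Φ` and `Ψ` alike), `B` finite FREE (torsion-free over the DVR),
  `π : B → O` the Yoshida branch, so that `A/IA = O`, `𝔭_A = I·A` and `Φ = ℓ_O(I_P/I_P²)`, while
  `Ψ = ℓ_O(O/η)` is the congruence module of the Yoshida branch at `P`. `Φ ≤ Ψ` =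
  [GMA: `Hom(B/IB, ·) ↪ Ext¹_ord`, Bellaïche–Chenevier §1.5 / Thm 1.5.5, + control of the Λ-adic
  Rankin–Selberg Selmer module `X` at `P` (Ochiai): `ℓ(I_P/I_P²) ≤ ℓ(X_P)`] + [Beilinson–Flach:
  `char X ∣ θ_{3,2}` — KLZ17 = arXiv:1503.02888 Thms 11.6.4/11.6.6, cyclotomic variable, under
  `(BI)`+`(NEZ)`; 3-variable form "expected", HP2025 = arXiv:2505.09975 p. 9] + [`θ_{3,2} ∣ 𝒞_Yos`:
  Hsieh–Liu (announced; HP2025 (1.4), p. 9); fixed weight AgarwalKlosin2013,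
  BochererDummiganSchulzePillot2012, BergerKlosin2012 Conj. 76] (risk c = THE BET; `μ`-parts and
  primes `P ∉ supp X` are included — there `Φ = Ψ = 0`); `reflects` = localisation algebra
  (`K_P = 0 ⇒ K ⊆ 𝔮` for every prime `𝔮 ⊆ P`).
* `classicalLimit`: a Galois point `y` on a modular component `V(𝔮)` (for irreducible `r` it is
  stable, 3-dimensional, finite and dominant over weight space) is a `p`-adic limit of classical
  points of regular weights `(k₁,k₂) ≡ (2,2) mod (p−1)p^m` (continuity of the finite fibres of
  `T/𝔮 → Λ₂`); their Galois representations (Weissauer2005, Urban2005: symplectic, ordinary of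
  regular shape, residually `r̄` hence distinguished; generic members stable ⇒ cuspidal on `GL₄`,
  GeeTaibi2019/Arthur2013) give `IsOrdinaryClassicalLimit r`.
Why it might fail: risks (a) (b) (c); `(yos)` forces non-minimal level (Ihara-type growth of `Ψ`
must match `Φ`); `p = 3`, dihedral/CM `σ̄`, `σ̄' ≅ σ̄ ⊗ χ` are inside the statement but outside
every Euler-system input (`(BI)`, `(tor)`; HP2025 Rem. 1.6: Rubin-type replacements); `𝕀` may be
non-normal at `P`. Cheap falsifiers already run by the panel: Wiles–Lenstra needs no finite residue
field ✓ (r1-2, r1-3); the two First lemmas are true ✓. Crux hypotheses used: `σ`-irreducibility and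
non-conjugacy (multiplicity-free residual pseudocharacter), `det` (orthogonal symplectic planes),
`ρ` irreducible (`x_ρ` on a stable component), `Sh ρ`; oddness is decoration (Disproof
`iff_withoutOdd`) and is not an argument. -/
theorem stub_yoshidaFamily :
    ∀ (p : ℕ) [Fact p.Prime], p ≠ 2 → ∀ (k : Type) [Field k] [CharP k p] [IsAlgClosed k]
      [TopologicalSpace k] [DiscreteTopology k] (red : Valued.integer (PadicAlgCl p) →+* k)
      (σ σ' : FramedGaloisRep ℚ k 2) (hcpt : isCompact_glFiniteIntegralLevel 4 ℚ) (ι : PadicAlgCl p ≃+* ℂ)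
      (ρ : FramedGaloisRep ℚ (PadicAlgCl p) 4),
      σ.toGaloisRep.IsIrreducible → σ'.toGaloisRep.IsIrreducible → DetC p k σ σ' →
      (¬ ∃ g : GL (Fin 2) k, ∀ x, g * σ x * g⁻¹ = σ' x) →
      ρ.toGaloisRep.IsIrreducible → Sh p k red σ σ' ρ →
      Nonempty (YoshidaFamilyDatum p hcpt ι k red σ σ' ρ) := by
  sorry

/-- **STUB 4 (XL, OPEN — the weight-(2,2) debt shared by every line on this crux) — ordinary
classical limits of Hodge–Tate shape `(0,0,1,1)` at an admissible Yoshida residual type are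
automorphic.** `p` odd; `σ̄, σ̄'` irreducible, non-conjugate, `det σ̄ = det σ̄' = ε̄⁻¹` (lead reshape
2026-08-16 after Disproof T4(a): the residual hypotheses are RESTORED, so that nothing is claimed at
residual types with four characters or `σ̄' ≅ σ̄`; the glue passes them); `r : Γ_ℚ → GL₄(ℚ̄_p)`
irreducible with `Sh r`; if `r` is an `IsOrdinaryClassicalLimit` (for every `n`, congruent mod `p^n`
on integral Frobenius polynomials, uniformly outside one finite `S`, to an AUTOMORPHIC symplectic
Greenberg-ordinary representation of REGULAR shape in the (2,2)-chamber) then `Aut r`.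
Intended proof: the approximants have bounded conductor (Swan conductors are residual once
`n ≥ 1`) and are ordinary of regular weight, so they are points of ONE finite `Λ₂`-algebra
`T^{ord}_N` (Hida / Tilouine–Urban / Pilloni2012 control + `GL₄ → GSp₄` descent, Arthur2013 /
GeeTaibi2019); finiteness over `Λ₂` makes the limit eigensystem a `ℚ̄_p`-point of `T^{ord}_N` over
weight `(2,2)` with pseudocharacter `tr r`; weight-2 classicality of `p`-distinguished ordinary
eigensystems of the higher-Hida complex (BoxerEtAl2021 §4–7, Pilloni2020: the eigensystem must be
found in `e·H⁰(X, ω²(−D))`, not only in `H¹`-torsion — OPEN at a Yoshida-congruent `𝔪`; barrier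
`NonRegularWeightBarrierNarrow`, evasion (i)) gives a weight-2 cuspidal Siegel eigenform, of general
type since `r` is irreducible, whose transfer to `GL₄` (GeeTaibi2019) is the `π` of `Aut`.
Why it might fail: `H¹`-torsion eigensystems at weight `(2,2)` with no classical avatar;
multiplicity one / Gorenstein-ness at an endoscopic-congruent `𝔪`. Implied by Langlands (B) for
`GL₄/ℚ`, strictly weaker than the target sector (hypothesis: a `p`-adic limit of automorphic, not
merely residually automorphic). `r.IsIrreducible` is load-bearing (Disproof
`not_withoutIrreducibleρ_of_witness`: `ρ_f ⊕ ρ_{f'}` is such a limit and is not cuspidal). -/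
theorem stub_ordinaryLimitClassicality :
    ∀ (p : ℕ) [Fact p.Prime], p ≠ 2 → ∀ (k : Type) [Field k] [CharP k p] [IsAlgClosed k]
      [TopologicalSpace k] [DiscreteTopology k] (red : Valued.integer (PadicAlgCl p) →+* k)
      (σ σ' : FramedGaloisRep ℚ k 2) (hcpt : isCompact_glFiniteIntegralLevel 4 ℚ) (ι : PadicAlgCl p ≃+* ℂ)
      (r : FramedGaloisRep ℚ (PadicAlgCl p) 4),
      σ.toGaloisRep.IsIrreducible → σ'.toGaloisRep.IsIrreducible → DetC p k σ σ' →
      (¬ ∃ g : GL (Fin 2) k, ∀ x, g * σ x * g⁻¹ = σ' x) →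
      r.toGaloisRep.IsIrreducible → Sh p k red σ σ' r → IsOrdinaryClassicalLimit p hcpt ι r →
      Aut p hcpt ι r := by
  sorry

/-! ## Consistency: each named statement IS its registered stub -/

theorem yoshidaFamilyExists_holds : YoshidaFamilyExists := stub_yoshidaFamily
theorem numericalCriterionDVR_holds : NumericalCriterionDVR := stub_numericalCriterionDVR  -- landed p78501
theorem stableComponentsModular_holds : StableComponentsModular := stub_stableComponentsModular  -- landed p73762
theorem ordinaryLimitClassicality_holds : OrdinaryLimitClassicality := stub_ordinaryLimitClassicality

/-! ## Name-keyed aliases of the statements (hypotheses of the composition, admissible BY NAME) -/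
namespace Registered

/-- Alias of `YoshidaFamilyExists` keyed by the registered stub name. -/
abbrev stub_yoshidaFamily : Prop := YoshidaFamilyExists
/-- Alias of `NumericalCriterionDVR` keyed by the registered stub name. -/
abbrev stub_numericalCriterionDVR : Prop := NumericalCriterionDVR
/-- Alias of `StableComponentsModular` keyed by the registered stub name. -/
abbrev stub_stableComponentsModular : Prop := StableComponentsModular
/-- Alias of `OrdinaryLimitClassicality` keyed by the registered stub name. -/
abbrev stub_ordinaryLimitClassicality : Prop := OrdinaryLimitClassicality

end Registered

/-! ## Glue (sorry-free) -/

/-- In a Yoshida family datum EVERY irreducible component of `Spec R` is modular: the height-one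
numerical criterion (STUB 2, landed theorem `stub_numericalCriterionDVR`) at each height-one prime
of the Yoshida divisor, read back through `reflects`, feeds the propagation lemma (STUB 3, landed
theorem `stub_stableComponentsModular`). -/
theorem modular_of_datum
    {p : ℕ} [Fact p.Prime] {hcpt : isCompact_glFiniteIntegralLevel 4 ℚ} {ι : PadicAlgCl p ≃+* ℂ}
    {k : Type} [Field k] [TopologicalSpace k] {red : Valued.integer (PadicAlgCl p) →+* k}
    {σ σ' : FramedGaloisRep ℚ k 2} {ρ : FramedGaloisRep ℚ (PadicAlgCl p) 4}
    (D : YoshidaFamilyDatum p hcpt ι k red σ σ' ρ) :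
    ∀ 𝔮 ∈ minimalPrimes D.R, D.K ≤ 𝔮 := by
  refine stub_stableComponentsModular D.R D.I D.K D.modular_le_reducible D.yoshida_minimal
    D.connected₂ D.generic_propagation ?_
  intro P hP hIP hdim 𝔮 h𝔮 hle
  obtain ⟨L⟩ := D.heightOne_criterion P hP hIP hdim
  exact L.reflects (stub_numericalCriterionDVR L.O L.A L.B L.φ L.π L.surjective L.eta_ne_bot
    L.phi_le_psi) 𝔮 h𝔮 hle

/-- Hence the point `x_ρ` lies on a modular component and `ρ` is an ordinary classical limit. -/
theorem isOrdinaryClassicalLimit_of_datum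
    {p : ℕ} [Fact p.Prime] {hcpt : isCompact_glFiniteIntegralLevel 4 ℚ} {ι : PadicAlgCl p ≃+* ℂ}
    {k : Type} [Field k] [TopologicalSpace k] {red : Valued.integer (PadicAlgCl p) →+* k}
    {σ σ' : FramedGaloisRep ℚ k 2} {ρ : FramedGaloisRep ℚ (PadicAlgCl p) 4}
    (D : YoshidaFamilyDatum p hcpt ι k red σ σ' ρ)
    (hirr : ρ.toGaloisRep.IsIrreducible) (hSh : Sh p k red σ σ' ρ) :
    IsOrdinaryClassicalLimit p hcpt ι ρ := by
  haveI : (RingHom.ker D.x).IsPrime := RingHom.ker_isPrime D.x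
  obtain ⟨𝔮, h𝔮, hle⟩ := Ideal.exists_minimalPrimes_le (bot_le : (⊥ : Ideal D.R) ≤ RingHom.ker D.x)
  exact D.classicalLimit ρ D.x hirr hSh D.charpoly_x ⟨𝔮, h𝔮, hle, modular_of_datum D 𝔮 h𝔮⟩

/-! ## The composition: the two OPEN stubs imply the crux, by name (STUBS 2–3 consumed as theorems) -/

/-- `ResiduallyYoshidaLifting` from the registered stubs (pure logic; no `sorry` here): the two
open ones (`stub_yoshidaFamily`, `stub_ordinaryLimitClassicality`) enter as name-keyed
hypotheses, the two landed ones (`stub_numericalCriterionDVR` p78501,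
`stub_stableComponentsModular` p73762) as imported theorems. -/
theorem ResiduallyYoshidaLifting_of (h₁ : Registered.stub_yoshidaFamily)
    (h₄ : Registered.stub_ordinaryLimitClassicality) :
    Summit.Langlands.Langlands.Theses.PhantomRMYoshida.ResiduallyYoshidaLifting := by
  intro p _ hp k _ _ _ _ _ red σ σ' hcpt ι ρ₀ ρ εbL AutL ShL hσodd hσ'odd hσirr hσ'irr hdet hnc
    hρ₀irr hSh₀ hAut₀ hρirr hShρ
  have hdet' : DetC p k σ σ' := hdet
  have hSh' : Sh p k red σ σ' ρ := hShρ
  obtain ⟨D⟩ := h₁ p hp k red σ σ' hcpt ι ρ hσirr hσ'irr hdet' hnc hρirr hSh'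
  exact h₄ p hp k red σ σ' hcpt ι ρ hσirr hσ'irr hdet' hnc hρirr hSh'
    (isOrdinaryClassicalLimit_of_datum D hρirr hSh')

/-- Wiring check: the registered stubs feed `ResiduallyYoshidaLifting_of` as stated. -/
example : Summit.Langlands.Langlands.Theses.PhantomRMYoshida.ResiduallyYoshidaLifting :=
  ResiduallyYoshidaLifting_of stub_yoshidaFamily stub_ordinaryLimitClassicality

end Summit.Langlands.Langlands.Cruxes.ResiduallyYoshidaLifting.YoshidaDivisorSelmerCount

end
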